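import Literature.AlgebraicGeometry.Resolution.StrictTransformFiniteFlattening
import Literature.AlgebraicGeometry.Resolution.BlowupFittingIdealFinitePresentation
import Mathlib.AlgebraicGeometry.Morphisms.FinitePresentation
import Mathlib.RingTheory.RingHom.FinitePresentation
import Mathlib.RingTheory.Finiteness.ModuleFinitePresentation
import HarnessLib

/-!
# Raynaud–Gruson flattening for finite morphisms over an affine base: finite presentation of the
# strict transform, and the full conclusion of Stacks 081R in this case

Topic: `Literature/AlgebraicGeometry/Resolution`. Completes `StrictTransformFiniteFlattening.lean`
(flatness) with the second half of the printed conclusion of Stacks 081R / Raynaud–Gruson 5.2.2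
— "the strict transform is flat AND OF FINITE PRESENTATION" — for a finite morphism
`f : X → S` of affine schemes which is finite locally free of rank `r` over `U = S ∖ V(K)`:
over the charts of the `U`-admissible blowing up in `K · Fit_r(Γ(X))` the strict transform is
`Spec` of a finitely presented (indeed finite locally free of rank `r`) algebra
(`finitePresentation_strictTransform_admissible`, `BlowupFittingIdealFinitePresentation.lean`).

* `locallyOfFinitePresentation_blowupStrictTransformMap_iff_ringHom` — the affine-chart
  criterion for local finite presentation of the strict transform;
* `ringHom_finitePresentation_quotient_powTorsion_of_module` — the algebraic bridge;
* `locallyOfFinitePresentation_blowupStrictTransformMap_admissible_of_isFinite_of_isAffine` —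
  the strict transform is locally of finite presentation;
* `exists_isBlowup_flat_lfp_blowupStrictTransformMap_of_isFinite` — **Stacks 081R for a finite
  morphism over an affine base: a `U`-admissible blowing up (finite type centre `K · Fit_r`,
  supported on `S ∖ U`) whose strict transform is flat and locally of finite presentation.**

## References

* M. Raynaud, L. Gruson, *Critères de platitude et de projectivité*, Invent. Math. 13 (1971),
  Première partie, Thm. 5.2.2, 5.4.2, 5.4.3. [RaynaudGruson1971]
* The Stacks Project, Tag 081R (Lemma 38.31.1), Tag 0811. [StacksProject]
-/

noncomputable section

open CategoryTheory CategoryTheory.Limits AlgebraicGeometry TopologicalSpace TensorProduct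

namespace Literature.AlgebraicGeometry.Resolution

universe u

open Literature.RingTheory.FittingIdeal Literature.AlgebraicGeometry.Limits

section Criterion

variable {X S S' : Scheme.{u}} (f : X ⟶ S) (b : S' ⟶ S) (I : S.IdealSheafData)

/-- **Finite presentation of the strict transform over an affine chart is finite presentation
of the torsion quotient**: with `X ×_S S'` and `S'` affine and `b⁻¹(S ∖ V(𝓘)) = D(t)`, `X' → S'` is locally of finite presentation iff
the ring map `Γ(S') → C/(t_C-power torsion)` (`C = Γ(X ×_S S')`) is of finite presentation — `X'` is affine
with `Γ(X') = C/(t_C-power torsion)`. [cite: StacksProject, Tag 0810 (proof, Step 8)] -/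
theorem locallyOfFinitePresentation_blowupStrictTransformMap_iff_ringHom [IsAffine (pullback f b)] [IsAffine S']
    (hE : IsEffectiveCartier (I.comap b)) (t : Γ(S', ⊤))
    (hO : b ⁻¹ᵁ centreCompl I = S'.basicOpen t) :
    LocallyOfFinitePresentation (blowupStrictTransformMap f b I) ↔
      ((Ideal.Quotient.mk (powTorsionIdeal ((pullback.snd f b).appTop t))).comp
        (pullback.snd f b).appTop.hom).FinitePresentation := by
  haveI : IsAffine (blowupStrictTransform f b I) := isAffine_of_isAffineHom (blowupStrictTransformι f b I)
  -- `Γ(X') = C / ker`, `ker` the ideal of `X'`, which is the torsion ideal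
  have hsurj : Function.Surjective (blowupStrictTransformι f b I).appTop :=
    (blowupStrictTransformι f b I).app_surjective ⊤ (isAffineOpen_top _)
  have hker : RingHom.ker (blowupStrictTransformι f b I).appTop.hom =
      powTorsionIdeal ((pullback.snd f b).appTop t) := by
    rw [← ideal_top_blowupStrictTransform_eq f b I hE t hO, ker_blowupStrictTransformι]
    exact Scheme.IdealSheafData.ker_subschemeι_app _ ⟨⊤, isAffineOpen_top _⟩
  -- the quotient presentation of `Γ(X')`
  let e : Γ(pullback f b, ⊤) ⧸ RingHom.ker (blowupStrictTransformι f b I).appTop.hom ≃+*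
      Γ(blowupStrictTransform f b I, ⊤) :=
    RingHom.quotientKerEquivOfSurjective hsurj
  have happ : (blowupStrictTransformMap f b I).appTop.hom =
      e.toRingHom.comp ((Ideal.Quotient.mk _).comp (pullback.snd f b).appTop.hom) := by
    change (blowupStrictTransformι f b I ≫ pullback.snd f b).appTop.hom = _
    rw [Scheme.Hom.comp_appTop, CommRingCat.hom_comp]
    ext x
    simp only [RingHom.comp_apply]
    exact (RingHom.quotientKerEquivOfSurjective_apply_mk hsurj _).symm
  rw [HasRingHomProperty.iff_of_isAffine (P := @LocallyOfFinitePresentation), happ]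
  -- transport along the ring isomorphism `e` and the equality of ideals `ker = torsion`
  constructor
  · intro h
    have h' := RingHom.finitePresentation_respectsIso.1 (e.toRingHom.comp ((Ideal.Quotient.mk _).comp
      (pullback.snd f b).appTop.hom)) e.symm h
    have hcomp : e.symm.toRingHom.comp (e.toRingHom.comp ((Ideal.Quotient.mk _).comp
        (pullback.snd f b).appTop.hom)) =
        (Ideal.Quotient.mk _).comp (pullback.snd f b).appTop.hom := by
      ext x
      simp
    rw [hcomp] at h'
    -- change the ideal along `hker`
    have h'' := RingHom.finitePresentation_respectsIso.1 _ (Ideal.quotEquivOfEq hker) h'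
    convert h'' using 1
    ext x
    simp [Ideal.quotEquivOfEq_mk]
  · intro h
    have h' := RingHom.finitePresentation_respectsIso.1 _ (Ideal.quotEquivOfEq hker.symm) h
    have hcomp : (Ideal.quotEquivOfEq hker.symm).toRingHom.comp
        ((Ideal.Quotient.mk (powTorsionIdeal ((pullback.snd f b).appTop t))).comp
          (pullback.snd f b).appTop.hom) =
        (Ideal.Quotient.mk _).comp (pullback.snd f b).appTop.hom := by
      ext x
      simp [Ideal.quotEquivOfEq_mk]
    rw [hcomp] at h'
    exact RingHom.finitePresentation_respectsIso.1 _ e h'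


end Criterion

/-! ## Algebra: transporting finite presentation of the torsion quotient -/

/-- **The algebraic bridge for finite presentation**: with `ρ₀ : R' → C`, a ring isomorphism
`E : C ≅ D` onto an `R'`-algebra with `E ∘ ρ₀ = algebraMap`, `E c = algebraMap t`, if the
`t`-power-torsion quotient of `D` is a finitely presented `R'`-module then
`R' → C → C/(c-power torsion)` is a ring map of finite presentation. [folklore] -/
theorem ringHom_finitePresentation_quotient_powTorsion_of_module {R' C D : Type u} [CommRing R']
    [CommRing C] [CommRing D] [Algebra R' D] (ρ₀ : R' →+* C) (E : C ≃+* D)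
    (hE : ∀ r, E (ρ₀ r) = algebraMap R' D r) (c : C) {t : R'} (hc : E c = algebraMap R' D t)
    (hfp : Module.FinitePresentation R' (D ⧸ (⨆ n : ℕ, Submodule.torsionBy R' D (t ^ n)))) :
    ((Ideal.Quotient.mk (powTorsionIdeal c)).comp ρ₀).FinitePresentation := by
  have hJ' : powTorsionIdeal (algebraMap R' D t) = (powTorsionIdeal c).map (E : C →+* D) := by
    rw [map_powTorsionIdeal_ringEquiv, hc]
  haveI : Module.FinitePresentation R' (D ⧸ powTorsionIdeal (algebraMap R' D t)) :=
    Module.FinitePresentation.of_equiv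
      ((Submodule.quotEquivOfEq _ _ (restrictScalars_powTorsionIdeal_algebraMap t)).symm ≪≫ₗ
        Submodule.Quotient.restrictScalarsEquiv R' (powTorsionIdeal (algebraMap R' D t)))
  haveI : Algebra.FinitePresentation R' (D ⧸ powTorsionIdeal (algebraMap R' D t)) :=
    Algebra.FinitePresentation.of_finitePresentation _ _
  have hfp' : (algebraMap R' (D ⧸ powTorsionIdeal (algebraMap R' D t))).FinitePresentation :=
    RingHom.finitePresentation_algebraMap.mpr inferInstance
  let e := Ideal.quotientEquiv (powTorsionIdeal c) (powTorsionIdeal (algebraMap R' D t)) E hJ'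
  have hcomp : (Ideal.Quotient.mk (powTorsionIdeal c)).comp ρ₀ =
      e.symm.toRingHom.comp (algebraMap R' (D ⧸ powTorsionIdeal (algebraMap R' D t))) := by
    ext r
    change _ = e.symm (Ideal.Quotient.mk _ (algebraMap R' D r))
    rw [← hE r, Ideal.quotientEquiv_symm_mk, RingEquiv.symm_apply_apply]
    rfl
  rw [hcomp]
  exact RingHom.finitePresentation_respectsIso.1 _ e.symm hfp'

/-! ## Finite presentation of the strict transform, and the full conclusion of Stacks 081R -/

section Scheme

variable {X S : Scheme.{u}} [IsAffine X] [IsAffine S] (f : X ⟶ S)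

/-- **Raynaud–Gruson flattening (Stacks 081R) for a finite morphism over an affine base,
`U`-admissible form.** Let `f : X → S` be a finite morphism of affine schemes, `R = Γ(S)`,
`B = Γ(X)`, `I = Fit_r(B)`, `K ⊆ R` an ideal with `Kⁿ Fit_k(B) = 0` for `k < r` (so `X` is
locally free of rank `r` over `U = S ∖ V(K)`), and `C ⊆ K ∩ I` a centre (e.g. `C = K · I`,
supported on `S ∖ U` when `Kᵐ ⊆ I`). Then for every `b : S' → S` pulling `V(C)` and `V(I)`
back to effective Cartier divisors — e.g. the blowing up of `S` in `K · I` — the strict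
transform of `X` along `b` (with respect to `V(C)`) is locally of finite presentation over `S'`
(it is finite locally free of rank `r` over the charts).
[cite: RaynaudGruson1971, Première partie 5.2.2; StacksProject, Tag 081R] -/
theorem locallyOfFinitePresentation_blowupStrictTransformMap_admissible_of_isFinite_of_isAffine [IsFinite f] {r : ℕ}
    {I K C : Ideal Γ(S, ⊤)}
    (hI : letI := f.appTop.hom.toAlgebra; Module.fittingIdeal Γ(S, ⊤) Γ(X, ⊤) r = I)
    (hK : letI := f.appTop.hom.toAlgebra;
      ∀ k < r, ∃ n : ℕ, K ^ n * Module.fittingIdeal Γ(S, ⊤) Γ(X, ⊤) k = ⊥)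
    (hCI : C ≤ I) (hCK : C ≤ K) {S' : Scheme.{u}} (b : S' ⟶ S)
    (hbC : IsEffectiveCartier ((Scheme.IdealSheafData.ofIdealTop C).comap b))
    (hbI : IsEffectiveCartier ((Scheme.IdealSheafData.ofIdealTop I).comap b)) :
    LocallyOfFinitePresentation (blowupStrictTransformMap f b (Scheme.IdealSheafData.ofIdealTop C)) := by
  letI algB : Algebra Γ(S, ⊤) Γ(X, ⊤) := f.appTop.hom.toAlgebra
  haveI : Module.Finite Γ(S, ⊤) Γ(X, ⊤) :=
    ((HasAffineProperty.iff_of_isAffine (P := @IsFinite) (f := f)).mp inferInstance).2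
  -- charts of `S'` on which both `I 𝒪` and `C 𝒪` are principal, `C 𝒪 = (c)`, `c` regular
  have hchart : ∀ x : S', ∃ (V : S'.affineOpens) (t₁ c : Γ(S', V)), x ∈ (V : S'.Opens) ∧
      c ∈ nonZeroDivisors Γ(S', V) ∧
      ((Scheme.IdealSheafData.ofIdealTop C).comap b).ideal V = Ideal.span {c} ∧
      ((Scheme.IdealSheafData.ofIdealTop I).comap b).ideal V = Ideal.span {t₁} := fun x => by
    obtain ⟨V₁, hxV₁, t₁, -, ht₁V₁⟩ := hbI x
    obtain ⟨V, hxV, hVV₁, c, hc, hcV⟩ := hbC.exists_chart_le x (V₁ : S'.Opens) hxV₁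
    refine ⟨V, S'.presheaf.map (homOfLE hVV₁).op t₁, c, hxV, hc, hcV, ?_⟩
    rw [← ((Scheme.IdealSheafData.ofIdealTop I).comap b).map_ideal (U := V) (V := V₁) hVV₁,
      ht₁V₁, Ideal.map_span, Set.image_singleton]
    rfl
  choose V t₁ c hxV hc hcV ht₁V using hchart
  let 𝒰 : S'.OpenCover := Scheme.Cover.mkOfCovers S' (fun x => ((V x : S'.Opens) : Scheme.{u}))
    (fun x => (V x : S'.Opens).ι) (fun x => ⟨x, ⟨x, hxV x⟩, rfl⟩) (fun x => inferInstance)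
  refine blowupStrictTransformMap_of_openCover_target f b _ @LocallyOfFinitePresentation hbC 𝒰 fun x => ?_
  change (S' : Type u) at x
  show LocallyOfFinitePresentation (blowupStrictTransformMap f ((V x : S'.Opens).ι ≫ b)
    (Scheme.IdealSheafData.ofIdealTop C))
  haveI : IsAffine ((V x : S'.Opens) : Scheme.{u}) := (V x).2
  have hTW : (⊤ : ((V x : S'.Opens) : Scheme.{u}).Opens) ≤
      (V x : S'.Opens).ι ⁻¹ᵁ (V x : S'.Opens) :=
    le_top.trans (Scheme.Opens.ι_preimage_self _).ge
  have hbij : Function.Bijective ((V x : S'.Opens).ι.appLE (V x) ⊤ hTW).hom :=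
    ConcreteCategory.bijective_of_isIso _
  -- the generators on the whole chart
  have hc' : ((V x : S'.Opens).ι.appLE (V x) ⊤ hTW) (c x) ∈
      nonZeroDivisors Γ((V x : S'.Opens), ⊤) :=
    mem_nonZeroDivisors_map_of_bijective _ hbij (hc x)
  have hideal : ∀ (J : Ideal Γ(S, ⊤)) (s : Γ(S', V x)),
      ((Scheme.IdealSheafData.ofIdealTop J).comap b).ideal (V x) = Ideal.span {s} →
      ((Scheme.IdealSheafData.ofIdealTop J).comap ((V x : S'.Opens).ι ≫ b)).ideal
        ⟨⊤, isAffineOpen_top _⟩ = Ideal.span {((V x : S'.Opens).ι.appLE (V x) ⊤ hTW) s} := by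
    intro J s hs
    rw [Scheme.IdealSheafData.comap_comp, ideal_comap_eq_map_of_le (V x : S'.Opens).ι _ (V x)
      ⟨⊤, isAffineOpen_top _⟩ hTW, hs, Ideal.map_span, Set.image_singleton]
  have hmap : ∀ J : Ideal Γ(S, ⊤), J.map ((V x : S'.Opens).ι ≫ b).appTop.hom =
      ((Scheme.IdealSheafData.ofIdealTop J).comap ((V x : S'.Opens).ι ≫ b)).ideal
        ⟨⊤, isAffineOpen_top _⟩ := by
    intro J
    have h := ideal_comap_preimage ((V x : S'.Opens).ι ≫ b) (Scheme.IdealSheafData.ofIdealTop J)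
      ⟨⊤, isAffineOpen_top _⟩ (isAffineOpen_top _)
    rw [Scheme.IdealSheafData.ofIdealTop_ideal,
      show (homOfLE (le_top : ((⟨⊤, isAffineOpen_top S⟩ : S.affineOpens) : S.Opens) ≤ ⊤)).op =
        𝟙 _ from Subsingleton.elim _ _, CategoryTheory.Functor.map_id, CommRingCat.hom_id,
      Ideal.map_id] at h
    exact h.symm
  have hCR' : C.map ((V x : S'.Opens).ι ≫ b).appTop.hom =
      Ideal.span {((V x : S'.Opens).ι.appLE (V x) ⊤ hTW) (c x)} := by
    rw [hmap, hideal C (c x) (hcV x)]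
  have hIR' : I.map ((V x : S'.Opens).ι ≫ b).appTop.hom =
      Ideal.span {((V x : S'.Opens).ι.appLE (V x) ⊤ hTW) (t₁ x)} := by
    rw [hmap, hideal I (t₁ x) (ht₁V x)]
  have hdiv : ((V x : S'.Opens).ι.appLE (V x) ⊤ hTW) (t₁ x) ∣
      ((V x : S'.Opens).ι.appLE (V x) ⊤ hTW) (c x) := by
    have hmem : ((V x : S'.Opens).ι.appLE (V x) ⊤ hTW) (c x) ∈
        I.map ((V x : S'.Opens).ι ≫ b).appTop.hom := by
      refine Ideal.map_mono hCI ?_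
      rw [hCR']
      exact Ideal.mem_span_singleton_self _
    rw [hIR'] at hmem
    obtain ⟨a, ha⟩ := Ideal.mem_span_singleton'.mp hmem
    exact ⟨a, by rw [mul_comm, ha]⟩
  have hcK : ((V x : S'.Opens).ι.appLE (V x) ⊤ hTW) (c x) ^ 1 ∈
      K.map ((V x : S'.Opens).ι ≫ b).appTop.hom := by
    rw [pow_one]
    refine Ideal.map_mono hCK ?_
    rw [hCR']
    exact Ideal.mem_span_singleton_self _
  -- the complement of the centre on the chart is `D(c)`
  have hO : ((V x : S'.Opens).ι ≫ b) ⁻¹ᵁ centreCompl (Scheme.IdealSheafData.ofIdealTop C) =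
      ((V x : S'.Opens) : Scheme.{u}).basicOpen (((V x : S'.Opens).ι.appLE (V x) ⊤ hTW) (c x)) := by
    rw [preimage_centreCompl]
    apply Opens.ext
    have h := inter_centreCompl_eq_basicOpen (⟨⊤, isAffineOpen_top _⟩ :
      ((V x : S'.Opens) : Scheme.{u}).affineOpens) _ (hideal C (c x) (hcV x))
    simpa only [Opens.coe_top, Set.univ_inter] using h
  have hEV : IsEffectiveCartier ((Scheme.IdealSheafData.ofIdealTop C).comap
      ((V x : S'.Opens).ι ≫ b)) := by
    rw [Scheme.IdealSheafData.comap_comp]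
    exact hbC.comap_of_isOpenImmersion _
  -- finite presentation over the chart is finite presentation of the torsion quotient
  refine (locallyOfFinitePresentation_blowupStrictTransformMap_iff_ringHom f
    ((V x : S'.Opens).ι ≫ b) _ hEV _ hO).mpr ?_
  -- `Γ(X ×_S V) ≅ Γ(V) ⊗_R B` over `Γ(V)`
  letI algR' : Algebra Γ(S, ⊤) Γ((V x : S'.Opens), ⊤) := ((V x : S'.Opens).ι ≫ b).appTop.hom.toAlgebra
  have hpo₁ := (isPushout_appTop_of_isPullback (IsPullback.of_hasPullback f ((V x : S'.Opens).ι ≫ b))).flip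
  have hpo₂ : IsPushout ((V x : S'.Opens).ι ≫ b).appTop f.appTop
      (CommRingCat.ofHom (Algebra.TensorProduct.includeLeftRingHom (R := Γ(S, ⊤))
        (A := Γ((V x : S'.Opens), ⊤)) (B := Γ(X, ⊤))))
      (CommRingCat.ofHom (Algebra.TensorProduct.includeRight (R := Γ(S, ⊤))
        (A := Γ((V x : S'.Opens), ⊤)) (B := Γ(X, ⊤))).toRingHom) :=
    CommRingCat.isPushout_tensorProduct Γ(S, ⊤) Γ((V x : S'.Opens), ⊤) Γ(X, ⊤)
  let E := (hpo₁.isoIsPushout _ _ hpo₂).commRingCatIsoToRingEquiv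
  have hE : ∀ y, E ((pullback.snd f ((V x : S'.Opens).ι ≫ b)).appTop y) =
      algebraMap Γ((V x : S'.Opens), ⊤) (Γ((V x : S'.Opens), ⊤) ⊗[Γ(S, ⊤)] Γ(X, ⊤)) y := fun y => by
    change ((pullback.snd f ((V x : S'.Opens).ι ≫ b)).appTop ≫ (hpo₁.isoIsPushout _ _ hpo₂).hom) y = _
    rw [hpo₁.inl_isoIsPushout_hom]
    rfl
  exact ringHom_finitePresentation_quotient_powTorsion_of_module _ E hE _ (hE _)
    (finitePresentation_strictTransform_admissible (R := Γ(S, ⊤)) (B := Γ(X, ⊤)) hI hK hdiv hIR'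
      hc' hcK)


/-- **Stacks 081R (Raynaud–Gruson 1971, Thm. 5.2.2) for a finite morphism over an affine base.**
Let `f : X → S` be a finite morphism of affine schemes, `R = Γ(S)`, `B = Γ(X)`,
`I = Fit_r(B)` finitely generated, and `K ⊆ R` finitely generated with `Kᵐ ⊆ I` and
`Kⁿ Fit_k(B) = 0` for `k < r` — i.e. `X` is finite locally free of rank `r` over the
quasi-compact open `U = S ∖ V(K)`. Then there are a finite type ideal sheaf (that of `K · I`)
with support `V(K)` disjoint from `U` and a blowing up `b : S' → S` of `S` in it (a
`U`-admissible blowing up) such that the strict transform of `X` along `b` is flat and locally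
of finite presentation over `S'` — the conclusion of `Stacks081R` for this class of `f`.
[cite: RaynaudGruson1971, Première partie Thm. 5.2.2; StacksProject, Tag 081R] -/
theorem exists_isBlowup_flat_lfp_blowupStrictTransformMap_of_isFinite [IsFinite f] {r : ℕ}
    {I K : Ideal Γ(S, ⊤)}
    (hI : letI := f.appTop.hom.toAlgebra; Module.fittingIdeal Γ(S, ⊤) Γ(X, ⊤) r = I)
    (hK : letI := f.appTop.hom.toAlgebra;
      ∀ k < r, ∃ n : ℕ, K ^ n * Module.fittingIdeal Γ(S, ⊤) Γ(X, ⊤) k = ⊥)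
    (hKI : ∃ m : ℕ, K ^ m ≤ I) (hKfg : K.FG) (hIfg : I.FG) :
    ∃ (𝓘 : S.IdealSheafData) (S' : Scheme.{u}) (b : S' ⟶ S),
      (∀ W : S.affineOpens, (𝓘.ideal W).FG) ∧
      Disjoint ((centreCompl (Scheme.IdealSheafData.ofIdealTop K) : S.Opens) : Set S)
        (𝓘.support : Set S) ∧
      IsBlowup b 𝓘 ∧ Flat (blowupStrictTransformMap f b 𝓘) ∧
      LocallyOfFinitePresentation (blowupStrictTransformMap f b 𝓘) := by
  obtain ⟨S', b, hb, hfg, hdisj, hflat⟩ :=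
    exists_isBlowup_flat_blowupStrictTransformMap_of_isFinite f hI hK hKI hKfg hIfg
  exact ⟨_, S', b, hfg, hdisj, hb, hflat,
    locallyOfFinitePresentation_blowupStrictTransformMap_admissible_of_isFinite_of_isAffine f hI hK
      Ideal.mul_le_left Ideal.mul_le_right b hb.isEffectiveCartier
      (isEffectiveCartier_comap_right_of_isBlowup_mul hb)⟩

end Scheme

end Literature.AlgebraicGeometry.Resolution

end
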